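import Summits.ValiantsHypothesis.ValiantsHypothesis.Theorems.NNDivisionHard.Negative.TropicalCalibration

/-!
# TropicalCalibration41 — PART 2: β-image circuits are constant-free over `𝕋`; the shadow of a cheap cofactor

Theorems-side port (val-port-1 g4; critic of record val-idea-crit-9 g4, V#161a kernel δ + V#162b PORT GO terms) of val-idea-41 g7's crux workfile
`Cruxes/NNDivisionHard/TropicalCalibration41.lean` @47b6585f5fb9 (sha16 e5b90f1af5f4ff04, 464 l.): declaration texts VERBATIM; split at the `end NN` seam into
`Theorems/NNDivisionHard/Negative/TropicalCalibration.lean` (𝕋 / `nnPolyS` / β / `tval` readings / `minNFPM`) and `…/Negative/TropicalCalibrationShadow.lean`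
(`BoolConstants` + the shadow of a cheap cofactor, ★ `booleanShadow_of_not_nnDivisionHard`); namespace `Summit.ValiantsHypothesis.Theorems.NNDivisionHardNegative.TropicalCalibration`.
CALIBRATION of record (¬ `NNDivisionHard` ⇒ a Boolean/tropical shadow), helper lane; nothing closes; `NNDivisionHard` (stmt-21181) OPEN; VP ≠ VNP NOT proved.
Part 1 = `…Negative.TropicalCalibration`.
-/


noncomputable section

open MvPolynomial
open scoped NNReal

namespace Summit.ValiantsHypothesis.Theorems.NNDivisionHardNegative.TropicalCalibration

open Literature.Computability.AlgebraicComplexity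
open Summit.ValiantsHypothesis.ValiantsHypothesis.Theses.FifoMatching (NNDivisionHard)

/-! ### β-image circuits are constant-free over `𝕋`: constants in `{0_𝕋, 1_𝕋} = {+∞, 0}` -/

section BoolConstants

variable {σ : Type*}

/-- Over `𝕋` the tree's constant-free predicate `IsSignConstant c` (`c = 0 ∨ c = 1 ∨ c + 1 = 0`)
reads `c ∈ {0_𝕋, 1_𝕋} = {+∞, 0}`: the alternative `c + 1 = 0`, i.e. `min (untrop c) 0 = +∞`, is
void. [folklore] -/
theorem isSignConstant_iff (c : 𝕋) : ArithCircuit.IsSignConstant c ↔ c = 0 ∨ c = 1 := by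
  unfold ArithCircuit.IsSignConstant
  constructor
  · rintro (h | h | h)
    · exact Or.inl h
    · exact Or.inr h
    · exfalso
      have h' := congrArg Tropical.untrop h
      rw [Tropical.untrop_add, Tropical.untrop_one, Tropical.untrop_zero] at h'
      exact absurd h' (ne_of_lt (lt_of_le_of_lt (min_le_right _ _) (WithTop.coe_lt_top 0)))
  · rintro (h | h)
    · exact Or.inl h
    · exact Or.inr (Or.inl h)

/-- operands of a `β`-mapped circuit have sign constants in `{0_𝕋, 1_𝕋}`. -/
theorem operandHasSignConstants_map (u : ArithCircuit.Operand ℝ≥0 σ) :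
    (u.map β).HasSignConstants := by
  cases u with
  | var i => trivial
  | const c =>
    show ArithCircuit.IsSignConstant (β c)
    rcases β_mem c with h | h
    · exact Or.inl h
    · exact Or.inr (Or.inl h)
  | gate j => trivial

/-- gates of a `β`-mapped circuit have sign constants in `{0_𝕋, 1_𝕋}`. -/
theorem gateHasSignConstants_map (g : ArithCircuit.Gate ℝ≥0 σ) : (g.map β).HasSignConstants := by
  cases g with
  | sum args =>
    intro a ha
    simp only [List.mem_map] at ha
    obtain ⟨a', -, rfl⟩ := ha
    refine ⟨?_, operandHasSignConstants_map a'.2⟩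
    rcases β_mem a'.1 with h | h
    · exact Or.inl h
    · exact Or.inr (Or.inl h)
  | prod args =>
    intro u hu
    simp only [List.mem_map] at hu
    obtain ⟨u', -, rfl⟩ := hu
    exact operandHasSignConstants_map u'

/-- The β-image of ANY circuit over `ℝ≥0` is constant-free over `𝕋` in the tree's sense
(`HasSignConstants`; by `isSignConstant_iff`: every constant and sum coefficient is `+∞` or `0`) —
so on inputs from `{+∞, 0}` a β-image circuit of size `s` only ever holds `+∞` or naturals `≤ 2^s`
(the register bound of the Boolean simulation, memo §2). [folklore] -/
theorem hasSignConstants_map_β (P : ArithCircuit ℝ≥0 σ) : (P.map β).HasSignConstants := by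
  refine ⟨fun g hg => ?_, operandHasSignConstants_map P.output⟩
  simp only [ArithCircuit.map, List.mem_map] at hg
  obtain ⟨g', -, rfl⟩ := hg
  exact gateHasSignConstants_map g'

end BoolConstants

/-! ### The shadow of a cheap cofactor -/

/-- **THE TROPICAL SHADOW (kernel form of «`¬ NNDivisionHard ⇒ ¬ C⁻`», HARVEST-g7-oqh §2 (i)).**
If the crux fails then for some `c` and infinitely many `n` there are a cofactor `h ≠ 0` and
fan-in-two monotone circuits `P₁ ∋ NN·h`, `P₂ ∋ h` of total size `≤ 2^((log₂ n + c)^c)` whose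
β-images — same gates, constants replaced by their zero pattern — are fan-in-two circuits over the
min-plus semiring `𝕋` of the same total size computing the tropical polynomials `map β (NN·h)` and
`map β h` (Jukna 2023, Cor. 6.4 with footnote 1: arithmetic `(+,×,/)` ↦ tropical `(min,+,−)`).
[cite: Jukna2023Tropical, Cor. 6.4] -/
theorem tropicalPair_of_not_nnDivisionHard (hneg : ¬ NNDivisionHard) :
    ∃ c : ℕ, ∀ n₀ : ℕ, ∃ n ≥ n₀, ∃ h : MvPolynomial (Fin (2 * n) × Fin (2 * n)) ℝ≥0, h ≠ 0 ∧
      ∃ P₁ P₂ : ArithCircuit ℝ≥0 (Fin (2 * n) × Fin (2 * n)),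
        P₁.IsFanInTwo ∧ P₂.IsFanInTwo ∧
        P₁.Computes (nnPolyS (2 * n) ℝ≥0 * h) ∧ P₂.Computes h ∧
        P₁.size + P₂.size ≤ 2 ^ ((Nat.log 2 n + c) ^ c) ∧
        (P₁.map β).IsFanInTwo ∧ (P₂.map β).IsFanInTwo ∧
        (P₁.map β).HasSignConstants ∧ (P₂.map β).HasSignConstants ∧
        (P₁.map β).size + (P₂.map β).size ≤ 2 ^ ((Nat.log 2 n + c) ^ c) ∧
        (P₁.map β).Computes (MvPolynomial.map β (nnPolyS (2 * n) ℝ≥0 * h)) ∧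
        (P₂.map β).Computes (MvPolynomial.map β h) := by
  rw [nnDivisionHard_iff] at hneg
  push Not at hneg
  obtain ⟨c, hc⟩ := hneg
  refine ⟨c, fun n₀ => ?_⟩
  obtain ⟨n, hn, h, hh, hle⟩ := hc n₀
  obtain ⟨P₁, h1f, h1c, h1s⟩ :=
    ArithCircuit.exists_computes_size_eq_complexity (nnPolyS (2 * n) ℝ≥0 * h)
  obtain ⟨P₂, h2f, h2c, h2s⟩ := ArithCircuit.exists_computes_size_eq_complexity h
  refine ⟨n, hn, h, hh, P₁, P₂, h1f, h2f, h1c, h2c, ?_, h1f.map β, h2f.map β,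
    hasSignConstants_map_β P₁, hasSignConstants_map_β P₂, ?_, h1c.map β, h2c.map β⟩
  · rw [h1s, h2s]; exact hle
  · rw [ArithCircuit.size_map, ArithCircuit.size_map, h1s, h2s]; exact hle

/-- **VALUE IDENTITY** for any circuits computing the pair (`value = eval (wt w) ∘ eval`, the value
the straight-line program takes on the inputs `wt w`, gate by gate, since `eval (wt w)` is a ring
homomorphism): `value(Q₁)(w) = minNFPM(w) + value(Q₂)(w)` in `ℕ ∪ {+∞}`, with `value(Q₂)(w)`
FINITE — arithmetic division has become subtraction of a finite quantity (Jukna 2023, footnote 1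
to Cor. 6.4). [cite: Jukna2023Tropical, Cor. 6.4] -/
theorem pair_values {n : ℕ} {h : MvPolynomial (Fin (2 * n) × Fin (2 * n)) ℝ≥0} (hh : h ≠ 0)
    {Q₁ Q₂ : ArithCircuit 𝕋 (Fin (2 * n) × Fin (2 * n))}
    (h1 : Q₁.Computes (MvPolynomial.map β (nnPolyS (2 * n) ℝ≥0 * h)))
    (h2 : Q₂.Computes (MvPolynomial.map β h)) (w : Fin (2 * n) × Fin (2 * n) → ℕ) :
    Tropical.untrop (MvPolynomial.eval (wt w) Q₁.eval) =
        minNFPM (2 * n) w + Tropical.untrop (MvPolynomial.eval (wt w) Q₂.eval) ∧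
      Tropical.untrop (MvPolynomial.eval (wt w) Q₂.eval) ≠ ⊤ := by
  unfold ArithCircuit.Computes at h1 h2
  rw [h1, h2]
  change Tropical.untrop (tval w (nnPolyS (2 * n) ℝ≥0 * h)) =
      minNFPM (2 * n) w + Tropical.untrop (tval w h) ∧ Tropical.untrop (tval w h) ≠ ⊤
  refine ⟨?_, untrop_tval_ne_top w hh⟩
  rw [tval_mul, Tropical.untrop_mul, untrop_tval_nnPolyS]

/-- In `ℕ ∪ {+∞}`: `m + a = a` with `a` finite forces `m = 0`. [folklore] -/
theorem eq_zero_of_add_eq_self_of_ne_top {m a : WithTop ℕ} (ha : a ≠ ⊤) (h : m + a = a) : m = 0 := by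
  obtain ⟨a, rfl⟩ := WithTop.ne_top_iff_exists.mp ha
  induction m using WithTop.recTopCoe with
  | top => simp at h
  | coe m =>
    have h' : ((m + a : ℕ) : WithTop ℕ) = (a : WithTop ℕ) := by push_cast; exact h
    have h'' : m + a = a := WithTop.coe_injective h'
    have hm : m = 0 := by omega
    simp [hm]

/-- **DECISION BY ONE EQUALITY TEST.** For any circuits computing the pair and any ordered graph
`G ⊆ arcs(K_{2n})`: `G` has a nest-free perfect matching iff the two circuit VALUES AGREE on the
0/1 weights `w_G` — the NP-complete shuffle-square shadow is decided by comparing two (min,+)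
straight-line values (register contents `+∞` or naturals `≤ 2^size`). [cite: BussSoltys2014, Thm 1] -/
theorem nfpm_iff_values_eq {n : ℕ} {h : MvPolynomial (Fin (2 * n) × Fin (2 * n)) ℝ≥0} (hh : h ≠ 0)
    {Q₁ Q₂ : ArithCircuit 𝕋 (Fin (2 * n) × Fin (2 * n))}
    (h1 : Q₁.Computes (MvPolynomial.map β (nnPolyS (2 * n) ℝ≥0 * h)))
    (h2 : Q₂.Computes (MvPolynomial.map β h)) (G : Finset (Fin (2 * n) × Fin (2 * n))) :
    (∃ M : Fin (2 * n) → Fin (2 * n),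
        ((∀ i, M (M i) = i) ∧ (∀ i, M i ≠ i) ∧ ∀ i j, i < j → j < M j → M j < M i → False) ∧
        ∀ i, i < M i → (i, M i) ∈ G) ↔
      MvPolynomial.eval (wt (indW G)) Q₁.eval = MvPolynomial.eval (wt (indW G)) Q₂.eval := by
  obtain ⟨hv, hfin⟩ := pair_values hh h1 h2 (indW G)
  rw [← minNFPM_eq_zero_iff]
  constructor
  · intro h0
    apply Tropical.untrop_injective
    rw [hv, h0, zero_add]
  · intro heq
    apply eq_zero_of_add_eq_self_of_ne_top hfin
    rw [← hv, heq]

/-- The tropical value of a polynomial with a nonzero CONSTANT TERM is `0` at every weight. [folklore] -/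
theorem untrop_tval_eq_zero_of_coeff_zero {σ : Type*} (w : σ → ℕ) {p : MvPolynomial σ ℝ≥0}
    (h0 : coeff 0 p ≠ 0) : Tropical.untrop (tval w p) = 0 := by
  rw [untrop_tval]
  apply le_antisymm _ bot_le
  refine (Finset.inf_le (MvPolynomial.mem_support_iff.mpr h0)).trans ?_
  simp [degW]

/-- **MONOTONE TIER (cofactors with a constant term).** If the cofactor `h` has `h(0) ≠ 0` then
already the FIRST circuit decides the shadow by a ZERO TEST: `G` has a nest-free perfect matching
iff `value(Q₁)(w_G) = 1_𝕋 (= 0)`.  On 0/1 weights the predicate «gate value `= 0`» propagates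
through a constant-free (min,+) circuit as OR (sum gates, over the operands with coefficient `1_𝕋`)
/ AND (product gates) of the same predicates, i.e. as a MONOTONE Boolean circuit of the same size
in the arc indicators `[e ∈ G]` (memo §2′): constant-term cofactors are ruled out by any monotone
lower bound `mSIZE(NFPM_{2n}) > 2^((log₂ n + c)^c)` — a Razborov/Alon–Boppana-genre statement, OPEN
for `NFPM`. [folklore] -/
theorem nfpm_iff_value_eq_one_of_constTerm {n : ℕ} {h : MvPolynomial (Fin (2 * n) × Fin (2 * n)) ℝ≥0}
    (h0 : coeff 0 h ≠ 0) {Q₁ : ArithCircuit 𝕋 (Fin (2 * n) × Fin (2 * n))}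
    (h1 : Q₁.Computes (MvPolynomial.map β (nnPolyS (2 * n) ℝ≥0 * h)))
    (G : Finset (Fin (2 * n) × Fin (2 * n))) :
    (∃ M : Fin (2 * n) → Fin (2 * n),
        ((∀ i, M (M i) = i) ∧ (∀ i, M i ≠ i) ∧ ∀ i j, i < j → j < M j → M j < M i → False) ∧
        ∀ i, i < M i → (i, M i) ∈ G) ↔
      MvPolynomial.eval (wt (indW G)) Q₁.eval = 1 := by
  have hv : Tropical.untrop (MvPolynomial.eval (wt (indW G)) Q₁.eval) = minNFPM (2 * n) (indW G) := by
    unfold ArithCircuit.Computes at h1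
    rw [h1]
    change Tropical.untrop (tval (indW G) (nnPolyS (2 * n) ℝ≥0 * h)) = minNFPM (2 * n) (indW G)
    rw [tval_mul, Tropical.untrop_mul, untrop_tval_nnPolyS, untrop_tval_eq_zero_of_coeff_zero _ h0,
      add_zero]
  rw [← minNFPM_eq_zero_iff, ← hv, ← Tropical.untrop_inj_iff, Tropical.untrop_one]

/-- **SUMMARY (the calibration's kernel half, one statement).** `¬ NNDivisionHard` puts, for some `c`
and infinitely many `n`, the NP-complete predicate «the ordered graph `G` on `[2n]` has a nest-free
perfect matching» in the form «two fan-in-two constant-free (constants in `{+∞, 0}`) (min,+)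
straight-line programs and total size `≤ 2^((log₂ n + c)^c)` take the same value on `w_G`».  (Paper, memo §2:
⇒ Boolean circuits of size `O(size²·log)` ⇒ SHUFFLE-SQUARE ∈ io-SIZE(2^{O((log n+c)^c)}).)
[cite: Jukna2023Tropical, Rem. 6.13] -/
theorem booleanShadow_of_not_nnDivisionHard (hneg : ¬ NNDivisionHard) :
    ∃ c : ℕ, ∀ n₀ : ℕ, ∃ n ≥ n₀, ∃ Q₁ Q₂ : ArithCircuit 𝕋 (Fin (2 * n) × Fin (2 * n)),
      Q₁.IsFanInTwo ∧ Q₂.IsFanInTwo ∧ Q₁.HasSignConstants ∧ Q₂.HasSignConstants ∧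
      Q₁.size + Q₂.size ≤ 2 ^ ((Nat.log 2 n + c) ^ c) ∧
      ∀ G : Finset (Fin (2 * n) × Fin (2 * n)),
        (∃ M : Fin (2 * n) → Fin (2 * n),
            ((∀ i, M (M i) = i) ∧ (∀ i, M i ≠ i) ∧ ∀ i j, i < j → j < M j → M j < M i → False) ∧
            ∀ i, i < M i → (i, M i) ∈ G) ↔
          MvPolynomial.eval (wt (indW G)) Q₁.eval = MvPolynomial.eval (wt (indW G)) Q₂.eval := by
  obtain ⟨c, hc⟩ := tropicalPair_of_not_nnDivisionHard hneg
  refine ⟨c, fun n₀ => ?_⟩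
  obtain ⟨n, hn, h, hh, P₁, P₂, -, -, -, -, -, h1f, h2f, h1b, h2b, hs, h1c, h2c⟩ := hc n₀
  exact ⟨n, hn, P₁.map β, P₂.map β, h1f, h2f, h1b, h2b, hs, fun G => nfpm_iff_values_eq hh h1c h2c G⟩

end Summit.ValiantsHypothesis.Theorems.NNDivisionHardNegative.TropicalCalibration
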